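/-
Copyright (c) 2026 the pub-hodgecm-mathlib formalisation cell (harness21).  Prover seat hodgecm-mathlib-K2E3-p26 (g2), Track B «K2-LIT» (valve hand → L1),
#184♮ = hLiu418 = `stmt-HodgeConjecture-24832`; socket #41, KIND 1, organ (K1b-W) (line lead K2Liu-p14 (g4), FILE CUT 2026-09-04T22:32:01Z, LINE WORD #1 (3) «=»),
brick (KW1-c) sub-brick (c2) «CHARACTER vs VALUATION».  THEOREMS ONLY (no `def`, no `instance`, no notation, no named-fact hypothesis, no `sorry`);
lane `--supports stmt-HodgeConjecture-24832` (count-neutral helper; closes no socket by itself).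
-/
import Literature.NumberTheory.Automorphic.AddCharConductorExponent   -- ★ `AddChar.HasConductorExp.mulShift`, `exists_normAbs_eq_inv_zpow`, `primePowBall_antitone`, `mem_primePowBall_adicCompletion_iff`, `normAbs_eq_inv_zpow_of_valued_eq`
import HarnessLib

/-!
# Crux `HLiu418`, socket #41, (K1b-W) brick (KW1-c) sub-brick (c2) — `K2LiuCharacterTrivialBallNormBound`: A CHARACTER `u ↦ ψ(a u)` TRIVIAL ON THE BALL `𝔭^n` HAS
# `‖a‖ ≤ q^{n − d}` (`d` = the conductor exponent of `ψ`) — «character trivial on the invariance lattice ⟹ the Fourier index is in the dual lattice»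

Cell `hodgecm-mathlib`, crux item hLiu418 = `stmt-HodgeConjecture-24832` (helper lane `--supports … --as helper`, count-neutral), route of record `HCCMUnconditional`;
squad K2 ∕ K2Liu (L1, LEAD F0P6-plan (g14) BATCH #79∕#82), road `K2_Liu`, socket #41, KIND 1, organ (K1b-W) (line lead K2Liu-p14 (g4)), brick (KW1-c)
`K2LiuKindOneLineWhittakerSupport` (the TOP's support letter `hsupp₁` at `n := 1` via ★ `K2LiuSiegelEisensteinKindWInstance.hsupp_of_local`), sub-brick (c2) of K2E3-p26 (g2)'s
sub-cut (K2 bus 2026-09-04T22:38:01Z; announced there as `K2LiuLineIndexValuationOfCharacterTrivial` — this file is its place-free core, the line-index dress `a = −2·dd·b` of the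
`n = 1` Skew carrier rides in the head).  Author K2E3-p26 (g2).

THE POINT.  ★ S-a `K2LiuBadPlaceWhittakerSkewInstance.forall_addChar_eq_one_of_setIntegral_ne_zero` says: a non-vanishing local Whittaker ball integral forces `ψ(−τ tr(β t₀)) = 1`
for every `t₀` in the invariance lattice `𝔭^n` of the section (the level, made explicit in the height by ★ (c1) `K2LiuLocalHeightLevelConjugation`).  At `n = 1` that character is
`u ↦ ψ_v(a·u)` on `L⁺_v` for a scalar `a` proportional to the line index, so the remaining step to the lattice letter `hloc` («`|index|_w ≤ q_w^m`») is the present elementary fact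
about additive characters of a non-archimedean local field `F` [BushnellHenniart2006, §1.7 Proposition], [Tate1950, §2.2], [WeilBNT1967, Ch. II §5]:
* §1 **`normAbs_le_of_forall_apply_mul_eq_one`** — if `ψ` has conductor exponent `d` (★ `AddChar.HasConductorExp`: `ψ|_{𝔭^d} = 1 ≠ ψ|_{𝔭^{d−1}}`) and `ψ(a·u) = 1` for all
  `u ∈ 𝔭^n` (★ `primePowBall F n`), then `‖a‖_F ≤ q^{−(d − n)}`, i.e. `a ∈ 𝔭^{d−n}` (`mem_primePowBall_of_forall_apply_mul_eq_one`).  Proof: for `a ≠ 0` with `‖a‖ = q^{−k}` the dilate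
  `aψ` has conductor exponent `d − k` (★ `AddChar.HasConductorExp.mulShift`), so it is non-trivial on `𝔭^{d−k−1}`; triviality on `𝔭^n` forces `n > d − k − 1`, i.e. `k ≥ d − n`.
* §2 **`v_le_exp_of_forall_apply_mul_eq_one`** — the same at the completion `K_v` of a number field in Mathlib's `Valued.v` currency (★ `mem_primePowBall_adicCompletion_iff`):
  `(∀ u, |u|_v ≤ exp(−n) → ψ(a u) = 1) ⟹ |a|_v ≤ exp(n − d)` — the shape the `hloc` letter of ★ `hsupp_of_local` consumes (`|mat i|_w ≤ exp m`).

HONEST LABEL.  Count-neutral helper; it retires nothing by itself: `HC_CM` is proved only modulo the 7 printed citations (2 remaining named inputs: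
hLiu418 = `stmt-HodgeConjecture-24832`, h413 = `stmt-HodgeConjecture-24833`) until rung 0 closes.

## References
* [BushnellHenniart2006] C. J. Bushnell, G. Henniart, *The local Langlands conjecture for GL(2)*, Grundlehren 335 (2006), §1.7 (level of a character; `aψ` has level `d − υ_F(a)`).
* [Tate1950] J. Tate, *Fourier analysis in number fields and Hecke's zeta-functions* (1950), in Cassels–Fröhlich (1967), Ch. XV §2.2 (conductor of `ψ`, dual lattices).
* [WeilBNT1967] A. Weil, *Basic Number Theory* (1967), Ch. II §5 (characters of local fields and their orders).
* [Casselman1980] W. Casselman, *The unramified principal series of p-adic groups I*, Compositio Math. 40 (1980), §3 (lattice support of Whittaker functionals).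
-/

set_option autoImplicit false
-- the mandated namespace repeats the single-problem summit's segment (`HodgeConjecture.HodgeConjecture`)
set_option linter.dupNamespace false

noncomputable section

open scoped NNReal WithZero
open NumberField IsDedekindDomain ValuativeRel
open Literature.NumberTheory.Automorphic Literature.NumberTheory.GaloisRepresentations
open Literature.NumberTheory.GaloisRepresentations.IsNonarchimedeanLocalField

namespace Summit.HodgeConjecture.HodgeConjecture.Cruxes.HLiu418.K2LiuCharacterTrivialBallNormBound

/-! ## §1 A non-archimedean local field: `ψ(a·𝔭^n) = 1 ⟹ a ∈ 𝔭^{d−n}` -/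

section Local

variable {F : Type*} [Field F] [ValuativeRel F] [TopologicalSpace F] [IsNonarchimedeanLocalField F]

/-- **A CHARACTER TRIVIAL ON A BALL HAS BOUNDED DILATION PARAMETER**: if `ψ` has conductor exponent `d` and `ψ(a·u) = 1` for every `u ∈ 𝔭^n`, then `‖a‖_F ≤ q^{−(d−n)}`.  For `a ≠ 0`,
`‖a‖ = q^{−k}`: the dilate `u ↦ ψ(a u)` has conductor exponent `d − k` (★ `AddChar.HasConductorExp.mulShift`), hence is `≠ 1` at some `u ∈ 𝔭^{d−k−1}`; were `d − k − 1 ≥ n` this `u`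
would lie in `𝔭^n` (★ `primePowBall_antitone`) — so `k ≥ d − n`. [cite: BushnellHenniart2006, §1.7 Proposition] [cite: Tate1950, §2.2] -/
theorem normAbs_le_of_forall_apply_mul_eq_one {ψ : AddChar F Circle} {d : ℤ} (hψ : ψ.HasConductorExp d) {a : F} {n : ℤ}
    (h : ∀ u ∈ primePowBall F n, ψ (a * u) = 1) :
    normAbs F a ≤ ((residueFieldCard F : ℝ≥0)⁻¹) ^ (d - n) := by
  by_cases ha0 : a = 0
  · rw [ha0, map_zero]; exact bot_le
  obtain ⟨k, hk⟩ := exists_normAbs_eq_inv_zpow ha0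
  -- the dilate `aψ` has conductor exponent `d − k`: non-trivial at some `u ∈ 𝔭^{d−k−1}`
  obtain ⟨u, hu, hne⟩ := (hψ.mulShift hk).2
  rw [AddChar.mulShift_apply] at hne
  have hlt : d - k - 1 < n := by
    by_contra hle
    exact hne (h u (primePowBall_antitone (not_lt.1 hle) hu))
  rw [hk]
  exact zpow_le_zpow_right_of_le_one₀ inv_residueFieldCard_pos inv_residueFieldCard_lt_one.le (by omega)

/-- The same in lattice words: `ψ(a·𝔭^n) = 1 ⟹ a ∈ 𝔭^{d−n}` (the dual lattice of `𝔭^n` under `(a, u) ↦ ψ(a u)` is `𝔭^{d−n}`). [cite: Tate1950, §2.2] [cite: WeilBNT1967, Ch. II §5] -/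
theorem mem_primePowBall_of_forall_apply_mul_eq_one {ψ : AddChar F Circle} {d : ℤ} (hψ : ψ.HasConductorExp d) {a : F} {n : ℤ}
    (h : ∀ u ∈ primePowBall F n, ψ (a * u) = 1) : a ∈ primePowBall F (d - n) :=
  mem_primePowBall_iff.2 (normAbs_le_of_forall_apply_mul_eq_one hψ h)

/-- Contrapositive, the form «`a ∉ 𝔭^{d−n}` ⟹ some `u ∈ 𝔭^n` has `ψ(a u) ≠ 1`» that ★ Φ5 F4a `setIntegral_eq_zero_of_unipotent_translate` ∕ ★ S-a
`setIntegral_ball_whittaker_eq_zero_of_translate` take as their witness `t₀` («`ψ(…t₀) ≠ 1`, `n(t₀)` in the invariance group»). [cite: Casselman1980, §3] [cite: Tate1950, §2.2] -/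
theorem exists_apply_mul_ne_one_of_not_mem {ψ : AddChar F Circle} {d : ℤ} (hψ : ψ.HasConductorExp d) {a : F} {n : ℤ}
    (ha : a ∉ primePowBall F (d - n)) : ∃ u ∈ primePowBall F n, ψ (a * u) ≠ 1 := by
  by_contra hno
  push Not at hno
  exact ha (mem_primePowBall_of_forall_apply_mul_eq_one hψ hno)

end Local

/-! ## §2 At the completion `K_v` of a number field, in `Valued.v` currency -/

section Completion

variable {K : Type} [Field K] [NumberField K] (v : HeightOneSpectrum (𝓞 K))

/-- **`(∀ u, |u|_v ≤ exp(−n) → ψ(a u) = 1) ⟹ |a|_v ≤ exp(n − d)`** at `K_v`, for `ψ` of conductor exponent `d` (§1 through the dictionary ★ `mem_primePowBall_adicCompletion_iff`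
`𝔭^m = {|·|_v ≤ exp(−m)}`).  This is the `|mat i|_w ≤ exp m` half of the `hloc` letter of ★ `hsupp_of_local`, with `m = n − d` read off the invariance lattice `𝔭^n` of the translated
section (★ (c1) `K2LiuLocalHeightLevelConjugation`: `n = c + 2a`, `q^a = H_w(g)`). [cite: BushnellHenniart2006, §1.7 Proposition] [cite: Casselman1980, §3] -/
theorem v_le_exp_of_forall_apply_mul_eq_one {ψ : AddChar (v.adicCompletion K) Circle} {d : ℤ} (hψ : ψ.HasConductorExp d) {a : v.adicCompletion K} {n : ℤ}
    (h : ∀ u : v.adicCompletion K, Valued.v u ≤ WithZero.exp (-n) → ψ (a * u) = 1) :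
    Valued.v a ≤ WithZero.exp (n - d) := by
  have h' : ∀ u ∈ primePowBall (v.adicCompletion K) n, ψ (a * u) = 1 := fun u hu => h u ((mem_primePowBall_adicCompletion_iff v).1 hu)
  have hmem := mem_primePowBall_of_forall_apply_mul_eq_one hψ h'
  rw [mem_primePowBall_adicCompletion_iff, neg_sub] at hmem
  exact hmem

/-- Contrapositive at `K_v`: `exp(n − d) < |a|_v ⟹ ∃ u, |u|_v ≤ exp(−n) ∧ ψ(a u) ≠ 1` — the witness `t₀` of the lattice-support clause. [cite: Casselman1980, §3] [cite: Tate1950, §2.2] -/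
theorem exists_apply_mul_ne_one_of_exp_lt_v {ψ : AddChar (v.adicCompletion K) Circle} {d : ℤ} (hψ : ψ.HasConductorExp d) {a : v.adicCompletion K} {n : ℤ}
    (ha : WithZero.exp (n - d) < Valued.v a) : ∃ u : v.adicCompletion K, Valued.v u ≤ WithZero.exp (-n) ∧ ψ (a * u) ≠ 1 := by
  by_contra hno
  push Not at hno
  exact not_le.2 ha (v_le_exp_of_forall_apply_mul_eq_one v hψ fun u hu => hno u hu)

end Completion

end Summit.HodgeConjecture.HodgeConjecture.Cruxes.HLiu418.K2LiuCharacterTrivialBallNormBound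

end
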